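import Mathlib
import Summits.NavierStokesRegularity.NavierStokesRegularity.Theorems.EulerZoomLiouvillePowerGaugeEulerLiouvilleSelfSimilarSphereBarriers
import Summits.NavierStokesRegularity.NavierStokesRegularity.Theorems.EulerZoomLiouvillePowerGaugeEulerLiouvilleSelfSimilarVorticityTransport
import HarnessLib.Audit

/-!
# Rung C1 of the crux `EulerZoomLiouville.PowerGaugeEulerLiouville` (the `C²` needle residue): THE NEEDLE MUST CARRY VORTICITY THROUGH
# EVERY LARGE SPHERE — if on spheres `S_R` beyond every radius the vorticity vanishes at every FAST-INFLOW point, the profile is trivial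

Route №10 `EulerZoomLiouville` (NavierStokesRegularity), crux E = stmt-NavierStokesRegularity-19832, registered residue
`stub_selfSimilarC2Needle` (THE ONE STATEMENT, skeleton v38 of the interim LEAD ns-typeII-p2 g10).  Sequel of `…SelfSimilarSphereBarriers`
(barrier spheres beyond every radius suffice).  Here the barrier is replaced by the weakest sphere condition the Lagrangian argument supports:

> for radii `R` beyond every bound, at every point `y` of the sphere `‖y‖ = R` where the flow enters AT LEAST AS FAST AS THE DRIFT,
> `⟪y, U y⟫ ≤ −γ‖y‖²` (i.e. `⟪y, W y⟫ ≤ 0`, `W = γy + U`), the vorticity vanishes: `curl U y = 0`.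

Then `curl U ≡ 0` (`curl_eq_zero_of_piercingIrrotational`) and the member is trivial (`selfSimilar_ae_eq_zero_of_piercingIrrotationalC2_profile`).
A sphere WITHOUT fast-inflow points satisfies the condition vacuously, so this contains the sphere-barrier stratum; its negation, carried by
THE ONE STATEMENT from v39 on, is the sharp needle portrait: for every large `R` some point of `S_R` has BOTH `⟪y, U y⟫ ≤ −γ‖y‖²` AND
`curl U y ≠ 0` — the needle is a VORTICAL fast-inflow channel through every large sphere.

Mechanism.  Take `R ≥ ‖x₀‖ + 1` from the hypothesis and the cutoff `Ṽ = U` on `B(0, R+1)` with global flow `Φ`.  For `x ∈ B(x₀, 1)` follow the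
backward `Ṽ`-orbit `Y(t) = Φ_{−t} x`.  EITHER it stays in `‖y‖ ≤ R` for all `t ≥ 0` — a confined backward `U`-half-orbit, and the vortical
points with such an orbit are Lebesgue-null (ns-typeII-p1 g8, `volume_vortical_confined_eq_zero`) — OR it has a FIRST EXIT TIME `t₁ > 0`:
`‖Y‖ < R` on `[0, t₁)`, `‖Y(t₁)‖ = R`, so `Y` is a `U`-orbit on `[0, t₁]` and `d/dt‖Y‖²(t₁) = −2⟪Y, W(Y)⟫ ≥ 0` (Fermat at a one-sided maximum,
`IsLocalMaxOn.hasFDerivWithinAt_nonpos`), i.e. `Y(t₁)` is a fast-inflow point of `S_R`, where `curl U = 0` by hypothesis; the weighted vorticity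
`e^{−(1+γ)t} curl U(Y(t))` solves the LINEAR Cauchy equation `u′ = −DW(Y) u` (`NodalFiniteness.hasDerivAt_weightedCurl_comp`) and vanishes at `t₁`,
hence at `0` (`ODE_solution_unique_of_mem_Icc_left`): `curl U x = 0`.  So the vortical points of `B(x₀,1)` are null, open, empty.

WHAT THIS IS NOT: not NS, not E, not rung C1 — a widening of the tame side of THE ONE STATEMENT; profiles whose needles are vortical through every large
sphere, the weak class and the non-self-similar members remain. [folklore; ConstantinIgnatovaVicol2026Putative §3.4.1 (3.22)–(3.24), §3.5 (setting)]
-/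

noncomputable section

set_option linter.dupNamespace false

open MeasureTheory Set Filter Topology Metric Function InnerProductSpace
open scoped RealInnerProductSpace NNReal ENNReal ContDiff

namespace Summit.NavierStokesRegularity.NavierStokesRegularity.Theorems.PowerGaugeEulerLiouville.Loc

open Literature.Analysis Literature.Analysis.FluidPDE
open Summit.NavierStokesRegularity.NavierStokesRegularity.Theorems.PowerGaugeEulerLiouville.Kelvin
open Summit.NavierStokesRegularity.NavierStokesRegularity.Theorems.PowerGaugeEulerLiouville.NodalFiniteness

variable {γ : ℝ} {U : EuclideanSpace ℝ (Fin 3) → EuclideanSpace ℝ (Fin 3)} {P : EuclideanSpace ℝ (Fin 3) → ℝ}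

/-- **THE NEEDLE MUST BE VORTICAL THROUGH EVERY LARGE SPHERE.**  `(U, P)` a `C²` profile of CIV (3.3) with `0 < γ < ½`; suppose there are radii
`R` beyond every bound such that on the sphere `‖y‖ = R` the vorticity vanishes at every fast-inflow point: `⟪y, U y⟫ ≤ −γ‖y‖² ⇒ curl U y = 0`.
Then `curl U ≡ 0`. [folklore] -/
theorem curl_eq_zero_of_piercingIrrotational (hprof : IsSelfSimilarEulerProfile γ 0 U P) (hγ : 0 < γ) (hγ2 : γ < 1 / 2)
    (hS : ∀ R₀ : ℝ, ∃ R : ℝ, R₀ ≤ R ∧ ∀ y : EuclideanSpace ℝ (Fin 3), ‖y‖ = R →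
      ⟪y, U y⟫ ≤ -(γ * ‖y‖ ^ 2) → curl U y = 0)
    (x₀ : EuclideanSpace ℝ (Fin 3)) : curl U x₀ = 0 := by
  have hU2 : ContDiff ℝ 2 U := hprof.contDiff_velocity
  have hU1 : ContDiff ℝ 1 U := hU2.of_le (by norm_num)
  obtain ⟨R, hR₀, hSR⟩ := hS (max (‖x₀‖ + 1) 1)
  have hR1 : 1 ≤ R := (le_max_right _ _).trans hR₀
  have hRx : ‖x₀‖ + 1 ≤ R := (le_max_left _ _).trans hR₀
  have hR : 0 < R := by linarith
  -- the cutoff field, `= U` on `ball 0 (R + 1)`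
  obtain ⟨V, hV, ⟨M, hVM⟩, -, ⟨K, hK⟩, hagree⟩ := exists_cutoff_local_smul hU2 (R := R + 1) (by linarith)
  have hV1 : ContDiff ℝ 1 V := hV.of_le (by norm_num)
  have hnear : ∀ z : EuclideanSpace ℝ (Fin 3), ‖z‖ ≤ R → V =ᶠ[𝓝 z] U := by
    intro z hz
    have hmem : ball (0 : EuclideanSpace ℝ (Fin 3)) (R + 1) ∈ 𝓝 z :=
      isOpen_ball.mem_nhds (by rw [mem_ball, dist_zero_right]; linarith)
    exact Filter.eventually_of_mem hmem fun y hy => hagree y hy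
  have hDeq : ∀ z : EuclideanSpace ℝ (Fin 3), ‖z‖ ≤ R → fderiv ℝ V z = fderiv ℝ U z :=
    fun z hz => (hnear z hz).fderiv_eq
  have hWeq : ∀ z : EuclideanSpace ℝ (Fin 3), ‖z‖ ≤ R →
      selfSimilarTransport γ 0 V z = selfSimilarTransport γ 0 U z := by
    intro z hz
    simp only [selfSimilarTransport_apply, hagree z (by rw [mem_ball, dist_zero_right]; linarith)]
  set Φ := ODE.evolutionMap (fun _ : ℝ => selfSimilarTransport γ 0 V) 0 with hΦ
  -- every vortical point near `x₀` has a confined backward `U`-half-orbit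
  have hsubset : {x : EuclideanSpace ℝ (Fin 3) | dist x x₀ < 1 ∧ curl U x ≠ 0} ⊆
      {x : EuclideanSpace ℝ (Fin 3) | curl U x ≠ 0 ∧
        ∃ Y : ℝ → EuclideanSpace ℝ (Fin 3), Y 0 = x ∧
          (∀ t, 0 ≤ t → HasDerivAt Y ((-1 : ℝ) • selfSimilarTransport γ 0 U (Y t)) t) ∧
          ∀ t, 0 ≤ t → ‖Y t‖ ≤ R} := by
    rintro x ⟨hx, hcx⟩
    have hxR : ‖x‖ < R := by
      have := norm_le_norm_add_norm_sub' x x₀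
      rw [← dist_eq_norm] at this
      linarith
    set Yp : ℝ → EuclideanSpace ℝ (Fin 3) := fun t => Φ (-t) x with hYp
    have hYpV : ∀ t, HasDerivAt Yp ((-1 : ℝ) • selfSimilarTransport γ 0 V (Yp t)) t :=
      fun t => C2.Kelvin.hasDerivAt_flow_neg (γ := γ) hV1 hK x t
    have hYpc : Continuous Yp := continuous_iff_continuousAt.2 fun t => (hYpV t).continuousAt
    have hYp0 : Yp 0 = x := by simp [hYp, hΦ, ODE.evolutionMap_self]
    have hYpU : ∀ t, ‖Yp t‖ ≤ R → HasDerivAt Yp ((-1 : ℝ) • selfSimilarTransport γ 0 U (Yp t)) t := by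
      intro t ht
      have h := hYpV t
      rwa [hWeq (Yp t) ht] at h
    by_cases hconf : ∀ t, 0 ≤ t → ‖Yp t‖ ≤ R
    · exact ⟨hcx, Yp, hYp0, fun t ht => hYpU t (hconf t ht), hconf⟩
    -- otherwise: FIRST EXIT through the sphere `‖y‖ = R`
    exfalso
    push Not at hconf
    obtain ⟨t₂, ht₂0, ht₂R⟩ := hconf
    set T : Set ℝ := {t | 0 ≤ t ∧ R ≤ ‖Yp t‖} with hT
    have hTne : T.Nonempty := ⟨t₂, ht₂0, ht₂R.le⟩
    have hTcl : IsClosed T := by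
      rw [hT, setOf_and]
      exact (isClosed_le continuous_const continuous_id).inter (isClosed_le continuous_const hYpc.norm)
    have hTbdd : BddBelow T := ⟨0, fun t ht => ht.1⟩
    set t₁ : ℝ := sInf T with ht₁
    have ht₁T : t₁ ∈ T := hTcl.csInf_mem hTne hTbdd
    have ht₁0 : 0 ≤ t₁ := ht₁T.1
    have hbefore : ∀ t, 0 ≤ t → t < t₁ → ‖Yp t‖ < R := by
      intro t ht0 htlt
      by_contra hge
      push Not at hge
      have : t₁ ≤ t := csInf_le hTbdd ⟨ht0, hge⟩
      linarith
    have ht₁pos : 0 < t₁ := by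
      rcases ht₁0.lt_or_eq with h | h
      · exact h
      · exfalso
        have := ht₁T.2
        rw [← h, hYp0] at this
        linarith
    -- `‖Yp t₁‖ = R` (continuity from the left)
    have hnorm₁ : ‖Yp t₁‖ = R := by
      refine le_antisymm ?_ ht₁T.2
      by_contra hgt
      push Not at hgt
      have hev : ∀ᶠ t in 𝓝 t₁, R < ‖Yp t‖ :=
        (hYpc.norm.continuousAt (x := t₁)).eventually (lt_mem_nhds hgt)
      obtain ⟨δ, hδ, hball⟩ := Metric.eventually_nhds_iff.1 hev
      set t : ℝ := max (t₁ - δ / 2) 0 with htdef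
      have ht0 : 0 ≤ t := le_max_right _ _
      have htlt : t < t₁ := by
        rw [htdef]; exact max_lt (by linarith) ht₁pos
      have hdist : dist t t₁ < δ := by
        rw [dist_comm, Real.dist_eq, abs_of_nonneg (by linarith)]
        have : t₁ - δ / 2 ≤ t := le_max_left _ _
        linarith
      have h1 := hball hdist
      have h2 := hbefore t ht0 htlt
      linarith
    have hin : ∀ t ∈ Icc 0 t₁, ‖Yp t‖ ≤ R := by
      intro t ht
      rcases ht.2.lt_or_eq with h | h
      · exact (hbefore t ht.1 h).le
      · rw [h, hnorm₁]
    -- Fermat at the one-sided maximum of `g = ‖Yp‖²` on `[0, t₁]`: `g′(t₁) ≥ 0`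
    set g : ℝ → ℝ := fun t => ‖Yp t‖ ^ 2 with hg
    have hg' : HasDerivAt g (2 * ⟪Yp t₁, (-1 : ℝ) • selfSimilarTransport γ 0 V (Yp t₁)⟫) t₁ := (hYpV t₁).norm_sq
    have hmax : IsLocalMaxOn g (Icc 0 t₁) t₁ := by
      refine Filter.eventually_of_mem self_mem_nhdsWithin fun t ht => ?_
      show ‖Yp t‖ ^ 2 ≤ ‖Yp t₁‖ ^ 2
      rw [hnorm₁]
      exact pow_le_pow_left₀ (norm_nonneg _) (hin t ht) 2
    have hcone : -t₁ ∈ posTangentConeAt (Icc (0 : ℝ) t₁) t₁ := by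
      refine mem_posTangentConeAt_of_segment_subset ?_
      rw [show t₁ + -t₁ = (0 : ℝ) by ring, segment_symm, segment_eq_Icc ht₁0]
    have hfermat := hmax.hasFDerivWithinAt_nonpos hg'.hasFDerivAt.hasFDerivWithinAt hcone
    -- so `⟪Y, W(Y)⟫ ≤ 0` at the exit point: a fast-inflow point of the sphere
    have hWY : ⟪Yp t₁, selfSimilarTransport γ 0 U (Yp t₁)⟫ ≤ 0 := by
      rw [← hWeq (Yp t₁) hnorm₁.le]
      have h1 : (-t₁) • (2 * ⟪Yp t₁, (-1 : ℝ) • selfSimilarTransport γ 0 V (Yp t₁)⟫) ≤ 0 := by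
        simpa using hfermat
      rw [inner_smul_right, smul_eq_mul] at h1
      nlinarith
    have hfast : ⟪Yp t₁, U (Yp t₁)⟫ ≤ -(γ * ‖Yp t₁‖ ^ 2) := by
      rw [selfSimilarTransport_apply, sub_zero, inner_add_right, inner_smul_right, real_inner_self_eq_norm_sq] at hWY
      linarith
    have hcurl₁ : curl U (Yp t₁) = 0 := hSR (Yp t₁) hnorm₁ hfast
    -- transport the zero back to `x` along the `U`-orbit: linear Cauchy equation + uniqueness
    set A : ℝ → EuclideanSpace ℝ (Fin 3) →L[ℝ] EuclideanSpace ℝ (Fin 3) :=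
      fun t => (-1 : ℝ) • fderiv ℝ (selfSimilarTransport γ 0 U) (Yp t) with hA
    set u : ℝ → EuclideanSpace ℝ (Fin 3) := fun s => Real.exp ((-1 : ℝ) * (1 + γ) * s) • curl U (Yp s) with hu
    have hu' : ∀ t ∈ Icc 0 t₁, HasDerivAt u (A t (u t)) t := fun t ht =>
      hasDerivAt_weightedCurl_comp hprof (hYpU t (hin t ht))
    have hKV : ∀ t ∈ Icc 0 t₁, LipschitzOnWith (Real.toNNReal (|γ| + K))
        (fun w : EuclideanSpace ℝ (Fin 3) => A t w) univ := by
      intro t ht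
      refine ((A t).lipschitz.weaken ?_).lipschitzOnWith
      have hK0 : 0 ≤ K := (norm_nonneg _).trans (hK 0)
      rw [← NNReal.coe_le_coe, coe_nnnorm, Real.coe_toNNReal _ (add_nonneg (abs_nonneg γ) hK0)]
      calc ‖A t‖ = ‖fderiv ℝ (selfSimilarTransport γ 0 U) (Yp t)‖ := by
            show ‖(-1 : ℝ) • fderiv ℝ (selfSimilarTransport γ 0 U) (Yp t)‖ = _
            rw [norm_smul, norm_neg, norm_one, one_mul]
        _ ≤ |γ| + K := by
            rw [fderiv_transport_eq hprof (Yp t)]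
            refine (norm_add_le _ _).trans (add_le_add ?_ ?_)
            · rw [norm_smul, Real.norm_eq_abs]
              exact mul_le_of_le_one_right (abs_nonneg γ) ContinuousLinearMap.norm_id_le
            · rw [← hDeq (Yp t) (hin t ht)]; exact hK _
    have hcont : ContinuousOn u (Icc 0 t₁) := fun t ht => (hu' t ht).continuousAt.continuousWithinAt
    have hut₁ : u t₁ = 0 := by simp [hu, hcurl₁]
    have hEq : EqOn u (fun _ => (0 : EuclideanSpace ℝ (Fin 3))) (Icc 0 t₁) :=
      ODE_solution_unique_of_mem_Icc_left (v := fun t w => A t w) (s := fun _ => univ)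
        (fun t ht => hKV t (Ioc_subset_Icc_self ht)) hcont
        (fun t ht => (hu' t (Ioc_subset_Icc_self ht)).hasDerivWithinAt) (fun _ _ => mem_univ _)
        continuousOn_const
        (fun t _ => by
          have h0 : HasDerivWithinAt (fun _ : ℝ => (0 : EuclideanSpace ℝ (Fin 3))) 0 (Iic t) t :=
            hasDerivWithinAt_const _ _ _
          simpa using h0)
        (fun _ _ => mem_univ _) (by simpa using hut₁)
    have hu0 : u 0 = 0 := hEq ⟨le_rfl, ht₁0⟩
    have : curl U x = 0 := by simpa [hu, hYp0] using hu0
    exact hcx this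
  have hnull := volume_vortical_confined_eq_zero hprof hγ hγ2 hR
  have hopen : IsOpen {x : EuclideanSpace ℝ (Fin 3) | dist x x₀ < 1 ∧ curl U x ≠ 0} := by
    have h1 : IsOpen {x : EuclideanSpace ℝ (Fin 3) | dist x x₀ < 1} := isOpen_lt (continuous_id.dist continuous_const) continuous_const
    exact h1.inter (isOpen_ne_fun (differentiable_curl_of_contDiff hU2).continuous continuous_const)
  have hzero : volume {x : EuclideanSpace ℝ (Fin 3) | dist x x₀ < 1 ∧ curl U x ≠ 0} = 0 := measure_mono_null hsubset hnull
  have hempty := (hopen.measure_eq_zero_iff volume).1 hzero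
  by_contra hx₀
  have : x₀ ∈ ({x : EuclideanSpace ℝ (Fin 3) | dist x x₀ < 1 ∧ curl U x ≠ 0} : Set _) := ⟨by simp, hx₀⟩
  rw [hempty] at this
  exact this

/-! ### Member level -/

/-- **MEMBER LEVEL — an exactly self-similar member of Seregin's power-gauged class whose `C²` velocity profile has, on spheres beyond every
radius, NO VORTICITY AT ITS FAST-INFLOW POINTS is trivial.**  Crux hypotheses verbatim (`0 < ρ ≤ ½`) + exact self-similarity + `V ∈ C²` +
radii `R` beyond every bound with `⟪y, V y⟫ ≤ −‖y‖²/(2+ρ) ⇒ curl V y = 0` on `‖y‖ = R` ⇒ `u = 0` a.e.  Contains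
`selfSimilar_ae_eq_zero_of_sphereBarriersC2_profile` (no fast-inflow points at all on the spheres). [folklore] -/
theorem selfSimilar_ae_eq_zero_of_piercingIrrotationalC2_profile {ρ : ℝ} (hρ : 0 < ρ) (hρ1 : ρ ≤ 1 / 2)
    {u : ℝ → EuclideanSpace ℝ (Fin 3) → EuclideanSpace ℝ (Fin 3)} {p : ℝ → EuclideanSpace ℝ (Fin 3) → ℝ}
    {H : ℝ → EuclideanSpace ℝ (Fin 3) → EuclideanSpace ℝ (Fin 3) →L[ℝ] EuclideanSpace ℝ (Fin 3)} {c : ℝ≥0}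
    (hsw : IsSuitableWeakSolutionOn (slab (EuclideanSpace ℝ (Fin 3)) (Iio 0) isOpen_Iio) 0 0 u p)
    (hgauge : ∀ a : ℝ, 0 < a →
      ENNReal.ofReal (a ^ (2 * ρ)) * cknA a (0 : ℝ × EuclideanSpace ℝ (Fin 3)) u +
          ENNReal.ofReal (a ^ ρ) * cknE a (0 : ℝ × EuclideanSpace ℝ (Fin 3)) H +
        ENNReal.ofReal (a ^ (2 * ρ)) * cknD a (0 : ℝ × EuclideanSpace ℝ (Fin 3)) p ≤ (c : ℝ≥0∞))
    {V : EuclideanSpace ℝ (Fin 3) → EuclideanSpace ℝ (Fin 3)} {P : EuclideanSpace ℝ (Fin 3) → ℝ}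
    (hu : ∀ τ : ℝ, τ < 0 → u τ = selfSimilarCollapse (1 / (2 + ρ)) 0 V τ)
    (hp : ∀ τ : ℝ, τ < 0 → p τ = selfSimilarCollapsePressure (1 / (2 + ρ)) 0 P τ)
    (hV : ContDiff ℝ 2 V)
    (hS : ∀ R₀ : ℝ, ∃ R : ℝ, R₀ ≤ R ∧ ∀ y : EuclideanSpace ℝ (Fin 3), ‖y‖ = R →
      ⟪y, V y⟫ ≤ -(1 / (2 + ρ) * ‖y‖ ^ 2) → curl V y = 0) :
    uncurry u =ᵐ[volume.restrict (Iio (0 : ℝ) ×ˢ (univ : Set (EuclideanSpace ℝ (Fin 3))))] 0 := by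
  -- adapted from `selfSimilar_ae_eq_zero_of_radialInflowC2_profile` (…SelfSimilarRadialBarrierLoc)
  have hρ1' : ρ < 1 := by linarith
  have h2ρ : (0 : ℝ) < 2 + ρ := by linarith
  have hγ : (0 : ℝ) < 1 / (2 + ρ) := one_div_pos.2 h2ρ
  have hγ2 : 1 / (2 + ρ) < 1 / 2 := one_div_lt_one_div_of_lt two_pos (by linarith)
  have hA : ∀ a : ℝ, 0 < a → ENNReal.ofReal (a ^ (2 * ρ)) *
      cknA a (0 : ℝ × EuclideanSpace ℝ (Fin 3)) u ≤ (c : ℝ≥0∞) :=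
    fun a ha => le_trans (le_trans le_self_add le_self_add) (hgauge a ha)
  have hD : ∀ a : ℝ, 0 < a → ENNReal.ofReal (a ^ (2 * ρ)) *
      cknD a (0 : ℝ × EuclideanSpace ℝ (Fin 3)) p ≤ (c : ℝ≥0∞) :=
    fun a ha => le_trans le_add_self (hgauge a ha)
  have hpm : AEStronglyMeasurable (uncurry p)
      (volume.restrict (Iio (0 : ℝ) ×ˢ (univ : Set (EuclideanSpace ℝ (Fin 3))))) := by
    have := hsw.distributional.2.2.1.aestronglyMeasurable
    simpa [slab] using this
  have hPm := aestronglyMeasurable_pressureProfile hpm hp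
  have hDprof := profile_pressure_weight_of_gaugeD hρ hρ1' hpm hp hD
  have hP1 : LocallyIntegrable P volume :=
    EnergySaturation.locallyIntegrable_pressure_of_weight hρ1' hPm
      (ENNReal.mul_ne_top ENNReal.ofReal_ne_top ENNReal.coe_ne_top) hDprof
  obtain ⟨P', hprof⟩ := WeakToClassical.exists_isSelfSimilarEulerProfile_of_contDiff hsw.distributional hu hp hV hP1
  have hcurl := curl_eq_zero_of_piercingIrrotational hprof hγ hγ2 hS
  exact Loc.selfSimilar_ae_eq_zero_of_irrotationalC2_profile hρ hsw.distributional hA hu hV hcurl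

end Summit.NavierStokesRegularity.NavierStokesRegularity.Theorems.PowerGaugeEulerLiouville.Loc
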